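import Summits.Ventures.Crystal3D.StickySpheres.ContactSeven
import Mathlib.Combinatorics.SimpleGraph.Finite
import HarnessLib

/-!
# The census statement in graph form: relaxed realisability of graphs with exactly `c_n + 1` edges

Venture `Crystal3D` (cell `pub-crystal3d`, seat p2), continuation of `SmallContactTable.lean` (p3) and `ContactSeven.lean`.
This is the bridge "Lemma R5" of the cell's `paper/REDUCTIONS.md` (lead 06:29Z design point, arithmetic checked by the
referee): it makes the Lean hypothesis LITERALLY the statement the enumeration engines decide.

* `RelaxedRealisable G` — a graph `G` on `Fin n` is relaxed-realisable if some configuration of `n` points of `ℝ³` has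
  distance exactly `1` along every edge of `G` and distance `≥ 1` between any two distinct points (non-edges are NOT
  required to be non-contacts: the engines' "relaxed semantics").
* `GraphStratumHypothesis d e n` — no graph on `Fin n` with exactly `e` edges and minimum degree `≥ d` is relaxed-realisable.
  This is what a complete sweep of `geng -d<d> n e:e` with exact refutations certifies. A HYPOTHESIS here, never proved
  (except that this file shows how the `n = 7` instance is bypassed: `C(7) = 15` is already unconditional).
* `stratumMinDeg_of_graphStratum` — **the bridge**: if `C(m) ≤ c'` and `d + c' ≤ c + 1`, then
  `GraphStratumHypothesis d (c + 1) (m + 1)` implies that every packing of `m + 1` balls has at most `c` contacts (so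
  `StratumHypothesisMinDeg d₀ c (m+1)` for every `d₀`). Proof: a packing with `e ≥ c + 1` contacts has every coordination
  `≥ e − c'` (remove the ball); ANY `c + 1` of its contact pairs form a graph `H` that the centres relaxed-realise, and each
  vertex lost at most `e − c − 1` of its edges, so `δ(H) ≥ (e − c') − (e − c − 1) ≥ d`.
* Consequences: the table `C(4..13) = 6, 9, 12, 15, 18, 21, 25, 29, 33, 36` from the six graph strata
  `GSH(d_n, c_n + 1, n)`, `8 ≤ n ≤ 13` (`maxContacts_eq_contactTable_of_graphStrata`, by induction on `n`, the bridge at each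
  step using the previous row), and the rows `C(8) = 18 ⇐ GSH(4, 19, 8)`, …, `C(13) = 36 ⇐ … ∧ GSH(4, 37, 13)`.

HONEST FRAMING: elementary combinatorics; the graph strata remain hypotheses; nothing about crystallization.
-/

noncomputable section

open Finset

namespace Summit.Ventures.Crystal3D

/-! ### 1. Definitions -/

/-- **Relaxed realisability** of a graph on `Fin n` in `ℝ³` (unit DIAMETER): some configuration has distance `1` along
every edge and distance `≥ 1` between distinct vertices (non-edges may or may not be contacts). [folklore] -/
def RelaxedRealisable {n : ℕ} (G : SimpleGraph (Fin n)) : Prop :=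
  ∃ x : Fin n → EuclideanSpace ℝ (Fin 3),
    (∀ i j, G.Adj i j → dist (x i) (x j) = 1) ∧ (∀ i j, i ≠ j → 1 ≤ dist (x i) (x j))

/-- **Graph stratum hypothesis `GSH(d, e, n)`**: no simple graph on `Fin n` with exactly `e` edges and all degrees `≥ d`
is relaxed-realisable in `ℝ³`. (The statement certified by a complete exact sweep of the graphs `geng -d<d> n e:e`.)
A hypothesis; not proved in the tree. [folklore] -/
def GraphStratumHypothesis (d e n : ℕ) : Prop :=
  ∀ G : SimpleGraph (Fin n), ∀ [DecidableRel G.Adj],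
    G.edgeFinset.card = e → (∀ i, d ≤ G.degree i) → ¬ RelaxedRealisable G

/-! ### 2. The bridge (Lemma R5) -/

section Bridge

variable {m : ℕ}

/-- The graph on `Fin N` whose edges are a given set `T` of ordered pairs `(i, j)`, `i < j`. [folklore] -/
def pairGraph {N : ℕ} (T : Finset (Fin N × Fin N)) : SimpleGraph (Fin N) :=
  SimpleGraph.fromEdgeSet ((T.image fun p => s(p.1, p.2) : Finset (Sym2 (Fin N))) : Set (Sym2 (Fin N)))

/-- Adjacency in `pairGraph T`. [folklore] -/
theorem pairGraph_adj {N : ℕ} {T : Finset (Fin N × Fin N)} (hT : ∀ p ∈ T, p.1 < p.2) {i j : Fin N} :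
    (pairGraph T).Adj i j ↔ (i, j) ∈ T ∨ (j, i) ∈ T := by
  rw [pairGraph, SimpleGraph.fromEdgeSet_adj, Finset.mem_coe, Finset.mem_image]
  constructor
  · rintro ⟨⟨p, hp, hpe⟩, -⟩
    rcases Sym2.eq_iff.1 hpe with ⟨h1, h2⟩ | ⟨h1, h2⟩
    · left; rw [← h1, ← h2]; exact hp
    · right; rw [← h1, ← h2]; exact hp
  · rintro (h | h)
    · exact ⟨⟨(i, j), h, rfl⟩, ne_of_lt (hT _ h)⟩
    · exact ⟨⟨(j, i), h, Sym2.eq_swap⟩, (ne_of_lt (hT _ h)).symm⟩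

/-- `pairGraph T` has exactly `|T|` edges. [folklore] -/
theorem card_edgeFinset_pairGraph {N : ℕ} {T : Finset (Fin N × Fin N)} (hT : ∀ p ∈ T, p.1 < p.2)
    [DecidableRel (pairGraph T).Adj] : (pairGraph T).edgeFinset.card = T.card := by
  classical
  have hE : (pairGraph T).edgeFinset = T.image fun p => s(p.1, p.2) := by
    ext e
    rw [SimpleGraph.mem_edgeFinset, pairGraph, SimpleGraph.edgeSet_fromEdgeSet, Set.mem_sdiff, Finset.mem_coe,
      Sym2.mem_diagSet]
    constructor
    · exact fun h => h.1
    · intro h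
      refine ⟨h, ?_⟩
      obtain ⟨p, hp, rfl⟩ := Finset.mem_image.1 h
      rw [Sym2.mk_isDiag_iff]
      exact ne_of_lt (hT p hp)
  rw [hE, Finset.card_image_of_injOn]
  intro p hp q hq hpq
  rcases Sym2.eq_iff.1 hpq with ⟨h1, h2⟩ | ⟨h1, h2⟩
  · exact Prod.ext h1 h2
  · exfalso
    have hp' := hT p hp
    have hq' := hT q hq
    rw [h1, h2] at hp'
    exact lt_asymm hp' hq'

/-- The degree of `i` in `pairGraph T` is at least the number of pairs of `T` containing `i`. [folklore] -/
theorem card_filter_le_degree_pairGraph {N : ℕ} {T : Finset (Fin N × Fin N)} (hT : ∀ p ∈ T, p.1 < p.2)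
    [DecidableRel (pairGraph T).Adj] (i : Fin N) :
    (T.filter fun p => ¬ (p.1 ≠ i ∧ p.2 ≠ i)).card ≤ (pairGraph T).degree i := by
  classical
  rw [← SimpleGraph.card_neighborFinset_eq_degree]
  refine Finset.card_le_card_of_injOn (fun p => if p.1 = i then p.2 else p.1) ?_ ?_
  · intro p hp
    rw [Finset.mem_coe, Finset.mem_filter] at hp
    obtain ⟨hpT, hpi⟩ := hp
    simp only [Finset.mem_coe, SimpleGraph.mem_neighborFinset, pairGraph_adj hT]
    split_ifs with h1
    · left
      have : p = (i, p.2) := Prod.ext h1 rfl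
      rw [← this]; exact hpT
    · right
      have h2 : p.2 = i := by
        by_contra h2
        exact hpi ⟨h1, h2⟩
      have : p = (p.1, i) := Prod.ext rfl h2
      rw [← this]; exact hpT
  · intro p hp q hq hpq
    rw [Finset.mem_coe, Finset.mem_filter] at hp hq
    obtain ⟨hpT, hpi⟩ := hp
    obtain ⟨hqT, hqi⟩ := hq
    have hp' := hT p hpT
    have hq' := hT q hqT
    simp only at hpq
    by_cases hp1 : p.1 = i <;> by_cases hq1 : q.1 = i <;> simp only [hp1, hq1, if_true, if_false] at hpq
    · exact Prod.ext (hp1.trans hq1.symm) hpq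
    · -- p = (i, p.2), q = (q.1, i): i < p.2 = q.1 < i
      have hq2 : q.2 = i := by by_contra h; exact hqi ⟨hq1, h⟩
      exfalso
      rw [hp1, hpq] at hp'
      rw [hq2] at hq'
      exact lt_asymm hp' hq'
    · have hp2 : p.2 = i := by by_contra h; exact hpi ⟨hp1, h⟩
      exfalso
      rw [hq1, ← hpq] at hq'
      rw [hp2] at hp'
      exact lt_asymm hp' hq'
    · have hp2 : p.2 = i := by by_contra h; exact hpi ⟨hp1, h⟩
      have hq2 : q.2 = i := by by_contra h; exact hqi ⟨hq1, h⟩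
      exact Prod.ext hpq (hp2.trans hq2.symm)

/-- **Lemma R5 (the bridge).** Let `C(m) ≤ c'` and `d + c' ≤ c + 1`. If no graph on `m + 1` vertices with exactly `c + 1`
edges and minimum degree `≥ d` is relaxed-realisable, then every packing of `m + 1` unit balls has at most `c` contacts.
[folklore] -/
theorem numContacts_le_of_graphStratum {c' c d : ℕ} (hC : maxContacts 3 m ≤ c') (hd : d + c' ≤ c + 1)
    (hG : GraphStratumHypothesis d (c + 1) (m + 1)) {x : Fin (m + 1) → EuclideanSpace ℝ (Fin 3)}
    (hx : IsUnitPacking x) : numContacts x ≤ c := by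
  classical
  by_contra hlt
  push Not at hlt
  -- coordinations are ≥ e − c'
  have hdeg : ∀ i, numContacts x ≤ coordination x i + c' := fun i =>
    (numContacts_le_add_maxContacts hx (le_refl (coordination x i))).trans (by omega)
  -- choose c + 1 contact pairs
  obtain ⟨T, hTA, hTcard⟩ := Finset.exists_subset_card_eq (s := contactPairs x) (n := c + 1)
    (by unfold numContacts at hlt; omega)
  have hT : ∀ p ∈ T, p.1 < p.2 := fun p hp => ((mem_contactPairs x).1 (hTA hp)).1
  -- the graph H = pairGraph T is relaxed-realised by x
  have hreal : RelaxedRealisable (pairGraph T) := by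
    refine ⟨x, fun i j hij => ?_, fun i j hij => hx.one_le_dist hij⟩
    rcases (pairGraph_adj hT).1 hij with h | h
    · exact ((mem_contactPairs x).1 (hTA h)).2
    · rw [dist_comm]; exact ((mem_contactPairs x).1 (hTA h)).2
  refine hG (pairGraph T) (by rw [card_edgeFinset_pairGraph hT, hTcard]) (fun i => ?_) hreal
  -- degree bound at i
  have h1 := card_filter_le_degree_pairGraph hT i
  have h2 : coordination x i ≤ (T.filter fun p => ¬ (p.1 ≠ i ∧ p.2 ≠ i)).card + (contactPairs x \ T).card := by
    rw [← card_contactPairs_filter_mem x i]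
    refine (Finset.card_le_card ?_).trans (Finset.card_union_le _ _)
    intro p hp
    rw [Finset.mem_filter] at hp
    rw [Finset.mem_union, Finset.mem_filter, Finset.mem_sdiff]
    by_cases hpT : p ∈ T
    · exact Or.inl ⟨hpT, hp.2⟩
    · exact Or.inr ⟨hp.1, hpT⟩
  have h3 : (contactPairs x \ T).card + (c + 1) = numContacts x := by
    rw [Finset.card_sdiff_of_subset hTA, hTcard, numContacts]
    have : c + 1 ≤ (contactPairs x).card := by rw [← hTcard]; exact Finset.card_le_card hTA
    omega
  have h4 := hdeg i
  omega

/-- The bridge in the cell's vocabulary: `GSH(d, c + 1, m + 1)` together with `C(m) ≤ c'`, `d + c' ≤ c + 1` gives the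
packing stratum `S_{d₀}(c, m + 1)` for every minimum degree `d₀` (the degree hypothesis is not even needed). [folklore] -/
theorem stratumMinDeg_of_graphStratum {c' c d : ℕ} (hC : maxContacts 3 m ≤ c') (hd : d + c' ≤ c + 1)
    (hG : GraphStratumHypothesis d (c + 1) (m + 1)) (d₀ : ℕ) : StratumHypothesisMinDeg d₀ c (m + 1) :=
  fun _ hx _ => numContacts_le_of_graphStratum hC hd hG hx

end Bridge

/-! ### 3. The table from the graph strata -/

/-- One row: if `C(m) = contactTable m` (`7 ≤ m ≤ 12`) and `GSH(d_{m+1}, c_{m+1} + 1, m + 1)` holds, then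
`C(m + 1) = contactTable (m + 1)`. [folklore] -/
theorem maxContacts_succ_eq_contactTable {m : ℕ} (h7 : 7 ≤ m) (h12 : m ≤ 12) (hm : maxContacts 3 m = contactTable m)
    (hG : GraphStratumHypothesis (minDegTable (m + 1)) (contactTable (m + 1) + 1) (m + 1)) :
    maxContacts 3 (m + 1) = contactTable (m + 1) := by
  have hS : StratumHypothesisMinDeg (minDegTable (m + 1)) (contactTable (m + 1)) (m + 1) := by
    refine stratumMinDeg_of_graphStratum hm.le ?_ hG _
    interval_cases m <;> simp [contactTable, minDegTable]
  refine maxContacts_eq_of_stratumMinDeg contactTable minDegTable (n₁ := m) (n₂ := m + 1) hm ?_ ?_ ?_ (m + 1)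
    (Nat.le_succ m) le_rfl
  · intro n hn hn'
    obtain rfl : n = m + 1 := le_antisymm hn' hn
    simp only [Nat.add_sub_cancel]
    interval_cases m <;> simp [contactTable, minDegTable]
  · intro n hn hn'
    obtain rfl : n = m + 1 := le_antisymm hn' hn
    exact contactTable_le_maxContacts (by omega) (by omega)
  · intro n hn hn'
    obtain rfl : n = m + 1 := le_antisymm hn' hn
    exact hS

/-- **The table from the graph strata.** If `GSH(d_n, c_n + 1, n)` holds for every `8 ≤ n ≤ 13` — no graph on `n` vertices
with exactly `c_n + 1` edges and minimum degree `≥ d_n` is relaxed-realisable (`(d_n, c_n + 1) = (4,19), (4,22), (5,26),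
(5,30), (5,34), (4,37)` for `n = 8, …, 13`) — then `C(n) = contactTable n` for every `4 ≤ n ≤ 13`. [folklore] -/
theorem maxContacts_eq_contactTable_of_graphStrata
    (hG : ∀ n, 8 ≤ n → n ≤ 13 → GraphStratumHypothesis (minDegTable n) (contactTable n + 1) n)
    {n : ℕ} (h4 : 4 ≤ n) (h13 : n ≤ 13) : maxContacts 3 n = contactTable n := by
  rcases Nat.lt_or_ge n 7 with hlt | h7
  · interval_cases n
    · simpa [contactTable] using maxContacts_three_four
    · simpa [contactTable] using maxContacts_three_five
    · simpa [contactTable] using maxContacts_three_six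
  · obtain ⟨k, rfl⟩ : ∃ k, n = 7 + k := ⟨n - 7, by omega⟩
    clear h4 h7
    induction k with
    | zero => simpa using maxContacts_three_seven_eq_contactTable
    | succ k ih =>
      exact maxContacts_succ_eq_contactTable (m := 7 + k) (by omega) (by omega) (ih (by omega))
        (hG _ (by omega) (by omega))

/-! ### 4. The rows, with the graph strata spelled out -/

/-- **`C(8) = 18`** if no graph on `8` vertices with exactly `19` edges and minimum degree `≥ 4` is relaxed-realisable.
[folklore] -/
theorem maxContacts_three_eight_of_graphStratum (h8 : GraphStratumHypothesis 4 19 8) : maxContacts 3 8 = 18 := by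
  have h := maxContacts_succ_eq_contactTable (m := 7) (by norm_num) (by norm_num) maxContacts_three_seven_eq_contactTable
    (by simpa [contactTable, minDegTable] using h8)
  simpa [contactTable] using h

/-- **`C(9) = 21`** from `GSH(4, 19, 8)` and `GSH(4, 22, 9)`. [folklore] -/
theorem maxContacts_three_nine_of_graphStrata (h8 : GraphStratumHypothesis 4 19 8) (h9 : GraphStratumHypothesis 4 22 9) :
    maxContacts 3 9 = 21 := by
  have h := maxContacts_succ_eq_contactTable (m := 8) (by norm_num) (by norm_num)
    (by simpa [contactTable] using maxContacts_three_eight_of_graphStratum h8)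
    (by simpa [contactTable, minDegTable] using h9)
  simpa [contactTable] using h

/-- **`C(10) = 25`** from `GSH(4, 19, 8)`, `GSH(4, 22, 9)`, `GSH(5, 26, 10)`. [folklore] -/
theorem maxContacts_three_ten_of_graphStrata (h8 : GraphStratumHypothesis 4 19 8) (h9 : GraphStratumHypothesis 4 22 9)
    (h10 : GraphStratumHypothesis 5 26 10) : maxContacts 3 10 = 25 := by
  have h := maxContacts_succ_eq_contactTable (m := 9) (by norm_num) (by norm_num)
    (by simpa [contactTable] using maxContacts_three_nine_of_graphStrata h8 h9)
    (by simpa [contactTable, minDegTable] using h10)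
  simpa [contactTable] using h

/-- **`C(11) = 29`** from `GSH(4, 19, 8)`, `GSH(4, 22, 9)`, `GSH(5, 26, 10)`, `GSH(5, 30, 11)`. [folklore] -/
theorem maxContacts_three_eleven_of_graphStrata (h8 : GraphStratumHypothesis 4 19 8) (h9 : GraphStratumHypothesis 4 22 9)
    (h10 : GraphStratumHypothesis 5 26 10) (h11 : GraphStratumHypothesis 5 30 11) : maxContacts 3 11 = 29 := by
  have h := maxContacts_succ_eq_contactTable (m := 10) (by norm_num) (by norm_num)
    (by simpa [contactTable] using maxContacts_three_ten_of_graphStrata h8 h9 h10)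
    (by simpa [contactTable, minDegTable] using h11)
  simpa [contactTable] using h

/-- **`C(12) = 33`** from the five graph strata up to `GSH(5, 34, 12)`. [folklore] -/
theorem maxContacts_three_twelve_of_graphStrata (h8 : GraphStratumHypothesis 4 19 8) (h9 : GraphStratumHypothesis 4 22 9)
    (h10 : GraphStratumHypothesis 5 26 10) (h11 : GraphStratumHypothesis 5 30 11) (h12 : GraphStratumHypothesis 5 34 12) :
    maxContacts 3 12 = 33 := by
  have h := maxContacts_succ_eq_contactTable (m := 11) (by norm_num) (by norm_num)
    (by simpa [contactTable] using maxContacts_three_eleven_of_graphStrata h8 h9 h10 h11)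
    (by simpa [contactTable, minDegTable] using h12)
  simpa [contactTable] using h

/-- **`C(13) = 36`** from the six graph strata up to `GSH(4, 37, 13)`. [folklore] -/
theorem maxContacts_three_thirteen_of_graphStrata (h8 : GraphStratumHypothesis 4 19 8)
    (h9 : GraphStratumHypothesis 4 22 9) (h10 : GraphStratumHypothesis 5 26 10) (h11 : GraphStratumHypothesis 5 30 11)
    (h12 : GraphStratumHypothesis 5 34 12) (h13 : GraphStratumHypothesis 4 37 13) : maxContacts 3 13 = 36 := by
  have h := maxContacts_succ_eq_contactTable (m := 12) (by norm_num) (by norm_num)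
    (by simpa [contactTable] using maxContacts_three_twelve_of_graphStrata h8 h9 h10 h11 h12)
    (by simpa [contactTable, minDegTable] using h13)
  simpa [contactTable] using h

/-! ### 5. Monotonicity of relaxed realisability (soundness of the deletion-lookup decider, PLAN R30) -/

/-- **Relaxed realisability passes to relabelled subgraphs.** If `G` on `Fin n` is relaxed-realisable, `f : Fin m → Fin n`
is injective and every edge of `H` maps to an edge of `G` (`H ≤ G.comap f`), then `H` is relaxed-realisable: restrict the
configuration along `f`. In particular `G − w` (any vertex `w` deleted, any edges dropped) is relaxed-realisable whenever
`G` is — the soundness of the cell's "delete a vertex and look the result up in the complete lower list" decider.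
[folklore] -/
theorem RelaxedRealisable.of_le_comap {m n : ℕ} {G : SimpleGraph (Fin n)} {H : SimpleGraph (Fin m)}
    (f : Fin m → Fin n) (hf : Function.Injective f) (hH : H ≤ G.comap f) (hG : RelaxedRealisable G) :
    RelaxedRealisable H := by
  obtain ⟨x, hxe, hxs⟩ := hG
  exact ⟨x ∘ f, fun i j hij => hxe (f i) (f j) (hH hij), fun i j hij => hxs (f i) (f j) (hf.ne hij)⟩

/-- Deleting the vertex `w`: the graph induced by `G` on `Fin n` minus `w`, relabelled by `Fin (n-1+1) … ` via `w.succAbove`,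
is relaxed-realisable whenever `G` is. [folklore] -/
theorem RelaxedRealisable.deleteVertex {n : ℕ} {G : SimpleGraph (Fin (n + 1))} (w : Fin (n + 1))
    (hG : RelaxedRealisable G) : RelaxedRealisable (G.comap w.succAbove) :=
  RelaxedRealisable.of_le_comap w.succAbove Fin.succAbove_right_injective le_rfl hG

/-- Contrapositive, as the decider uses it: if some vertex-deleted relabelled subgraph is NOT relaxed-realisable, neither
is `G`. [folklore] -/
theorem not_relaxedRealisable_of_deleteVertex {n : ℕ} {G : SimpleGraph (Fin (n + 1))} (w : Fin (n + 1))
    {H : SimpleGraph (Fin n)} (hH : H ≤ G.comap w.succAbove) (hno : ¬ RelaxedRealisable H) : ¬ RelaxedRealisable G :=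
  fun hG => hno (RelaxedRealisable.of_le_comap w.succAbove Fin.succAbove_right_injective hH hG)

end Summit.Ventures.Crystal3D

end
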